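import Literature.AnabelianGeometry.AbsoluteAnabelian.NumberFieldValuationProSet
import Literature.AnabelianGeometry.AbsoluteAnabelian.NFGaloisTFGNormalProofs
import Literature.AnabelianGeometry.AbsoluteAnabelian.GaloisSubextensionProofs
import Literature.AnabelianGeometry.AbsoluteAnabelian.AbsTopIThm26UniversalClosuresRefuted
import Literature.AnabelianGeometry.AbsoluteAnabelian.AbsTopI.ChainTransport
import HarnessLib

/-!
# [AbsTopIII] Def 5.1 (ii) at the number-field ARITHMETIC SHADOW: the genuine fields of a `GlobalAnabelianContext`

S. Mochizuki, *Topics in absolute anabelian geometry III* [MochizukiAbsTopIII2015], Def 5.1 (ii) pp. 113–114 (the data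
"functorially constructed from `Π_X`": `Δ_X` "the maximal topologically finitely generated closed normal subgroup",
`k_NF(Π_X) ≅ F̄`, `V⊚(Π_X)`, `X(Π_X, v)`, `δ_{ell,v}`, `κ_{ell,v}`), typed by the cell as the INTERFACE structure
`GlobalAnabelianContext` (`GaloisTheaters.lean`, abc-iut-L4-t3).

THIS DEF-BEARING FILE (abc-iut-L4-d2, row «COR52III-CONTEXT-SHADOW», abc-iut-L4-lead RULING #6j) records — as STANDALONE
definitions and theorems, decl by decl — every field of that interface that IS constructible today at the number-field
model, HONESTLY LABELLED:

* **the model is the ARITHMETIC SHADOW, NOT print's `Π_X`**: `NumberFieldShadow.extension F = (G_F →(id) G_F)` (`Δ = 1`);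
  print's `Ob(EA⊚)` consists of the `Π_X` of elliptically admissible hyperbolic orbicurves, which the tree cannot construct
  (no étale `π₁`; campaign-L).  `IsAdmissible E := Nonempty (E ≅ extension F)` is iso-closed, and the interface axiom
  `geom_isMax` HOLDS GENUINELY at the shadow (`isMaxTopFGClosedNormal_geom_of_isAdmissible`): every topologically finitely
  generated closed normal subgroup of `G_F` is trivial — [AbsAnab] Thm 1.1.2, the tree's F-0031
  `galoisNF_tfgNormalSubgroup_trivial_holds` (abc-iut-L4-d2 g3), transported along `E.arith ≅ G_F`;
* `k_NF`: `F̄` with the genuine Galois action pulled back along the admissibility isomorphism (`shadowHom`, `shadowAction`);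
* `V⊚`: the GENUINE valuation pro-set `NumberField.valuationProSet F` (`NumberFieldValuationProSet.lean`) pulled back along
  `shadowHom` (`GaloisProSet.comap`, `shadowProVal`);
* `X(Π, v)`, `δ_{ell,v}`, `κ_{ell,v}`: the STUB `AutHolOrbispace` (axiom-free in the tree) filled by the point orbispace with
  `A_X := ℂ` and `π₁^∧ := Δ` itself (`δ := id`) — NO geometry; `κ_{ell,v} : F̄ →+* ℂ` is the GENUINE complex embedding of the
  infinite place under `v` (`shadowKappa`).

NOT ASSEMBLED: the `GlobalAnabelianContext` TERM itself — its functoriality field `mapProVal` with the law `mapProVal_smul`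
demands, for every open injection between admissible objects, an equivariant self-homeomorphism of `V⊚(F̄/F)`, i.e. that
automorphisms / open self-embeddings of `G_F` permute decomposition groups: Neukirch's local correspondence
(Neukirch–Uchida; [AbsAnab] Thm 1.1.3, "not typed") — the cell's GAP row G-L4d2g4-1.  Nothing here bears on [IUTchIII]
Cor. 3.12 or takes a side; shadow ≠ print's instance; typed ≠ proved.  No `instance`/`notation`/attribute changes.
-/

noncomputable section

open scoped Pointwise Topology Classical
open CategoryTheory NumberField

namespace Literature.AnabelianGeometry.AbsoluteAnabelian

open Field

universe u

/-! ### Transport of a Galois pro-set along a continuous homomorphism -/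

/-- Pull back a `GaloisProSet` along a continuous homomorphism `φ : Q →ₜ* P`: same carrier, `q • v := φ q • v`.
[cite: MochizukiAbsTopIII2015, Def 5.1 (ii) p.114] -/
def GaloisProSet.comap {P Q : Type u} [Group P] [TopologicalSpace P] [Group Q] [TopologicalSpace Q]
    (V : GaloisProSet P) (φ : Q →ₜ* P) : GaloisProSet Q :=
  letI : MulAction Q V.carrier := MulAction.compHom V.carrier φ.toMonoidHom
  haveI : ContinuousSMul Q V.carrier :=
    ⟨show Continuous (fun p : Q × V.carrier => φ p.1 • p.2) from
      (φ.continuous.comp continuous_fst).smul continuous_snd⟩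
  { carrier := V.carrier
    generic := V.generic
    non := V.non
    arc := V.arc
    smul_generic := fun q => V.smul_generic (φ q)
    generic_notMem_non := V.generic_notMem_non
    generic_notMem_arc := V.generic_notMem_arc
    disjoint_non_arc := V.disjoint_non_arc
    eq_generic_or_mem := V.eq_generic_or_mem
    smul_mem_non := fun q _ hv => V.smul_mem_non (φ q) hv
    smul_mem_arc := fun q _ hv => V.smul_mem_arc (φ q) hv }

/-- Decomposition groups of the pulled-back pro-set are preimages. [cite: MochizukiAbsTopIII2015, Def 5.1 (iii) p.115] -/
theorem GaloisProSet.decomp_comap {P Q : Type u} [Group P] [TopologicalSpace P] [Group Q] [TopologicalSpace Q]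
    (V : GaloisProSet P) (φ : Q →ₜ* P) (v : V.carrier) :
    (V.comap φ).decomp v = (V.decomp v).comap φ.toMonoidHom := by
  ext q
  rfl

namespace NumberFieldShadow

variable (F : Type) [Field F] [NumberField F]

/-! ### The shadow extension `E_F = (G_F → G_F)` and admissibility -/

/-- The ARITHMETIC SHADOW of `Π_X ↠ G_F`: the extension `G_F →(id) G_F` (`Δ = 1`).  NOT print's `Π_X` (no curve).
[cite: MochizukiAbsTopIII2015, Def 5.1 (ii) p.113] -/
def extension : FundamentalExtension.{0} where
  arith := absoluteGaloisGrp F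
  gal := absoluteGaloisGrp F
  aug := ContinuousMonoidHom.id _
  aug_surjective := fun x => ⟨x, rfl⟩

/-- `Δ = 1` for the shadow extension. [cite: MochizukiAbsTopIII2015, Def 5.1 (ii) p.113] -/
theorem geom_extension_eq_bot : (extension F).geom = ⊥ := by
  ext x
  rw [FundamentalExtension.mem_geom, Subgroup.mem_bot]
  exact Iff.rfl

/-- Shadow admissibility (`Ob(EA⊚)` at the shadow): extensions isomorphic to `E_F`.
[cite: MochizukiAbsTopIII2015, Def 5.1 (ii) p.114] -/
def IsAdmissible (E : FundamentalExtension.{0}) : Prop := Nonempty (E ≅ extension F)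

/-- `E_F` itself is admissible. [cite: MochizukiAbsTopIII2015, Def 5.1 (ii) p.114] -/
theorem isAdmissible_extension : IsAdmissible F (extension F) := ⟨Iso.refl _⟩

/-- Admissibility is closed under isomorphism. [cite: MochizukiAbsTopIII2015, Def 5.1 (ii) p.114] -/
theorem isAdmissible_of_iso {E₁ E₂ : FundamentalExtension.{0}} (e : E₁ ≅ E₂) (h : IsAdmissible F E₁) :
    IsAdmissible F E₂ := by
  obtain ⟨e₁⟩ := h
  exact ⟨e.symm ≪≫ e₁⟩

/-- `Δ = 1` for every admissible extension. [cite: MochizukiAbsTopIII2015, Def 5.1 (ii) p.113] -/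
theorem geom_eq_bot_of_isAdmissible {E : FundamentalExtension.{0}} (h : IsAdmissible F E) : E.geom = ⊥ := by
  obtain ⟨e⟩ := h
  rw [eq_bot_iff]
  intro x hx
  have h1 : e.hom.arith x ∈ (extension F).geom := FundamentalExtension.Hom.mapsTo_geom e.hom hx
  rw [geom_extension_eq_bot, Subgroup.mem_bot] at h1
  rw [Subgroup.mem_bot]
  have h1' : AbsTopI.isoArith e x = 1 := h1
  exact (AbsTopI.isoArith e).injective (by rw [h1', map_one])

/-- **The interface axiom `geom_isMax` holds GENUINELY at the shadow**: for an admissible `E`, `Δ_E (= 1)` is the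
maximal topologically finitely generated closed normal subgroup of `Π_E ≅ G_F` — because EVERY topologically finitely
generated closed normal subgroup of `G_F` is trivial ([AbsAnab] Thm 1.1.2 = F-0031 `galoisNF_tfgNormalSubgroup_trivial_holds`,
transported along `Π_E ≅ G_F`). [cite: MochizukiAbsAnab2004, Thm 1.1.2 p.6] -/
theorem isMaxTopFGClosedNormal_geom_of_isAdmissible {E : FundamentalExtension.{0}} (h : IsAdmissible F E) :
    IsMaxTopFGClosedNormal E.geom := by
  have hbot := geom_eq_bot_of_isAdmissible F h
  obtain ⟨e⟩ := h
  refine ⟨inferInstance, E.isClosed_geom, ?_, ?_⟩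
  · haveI : Subsingleton E.geom := by
      rw [hbot]
      infer_instance
    exact isTopologicallyFinitelyGenerated_of_subsingleton
  · intro N hN hNc htfg
    rw [hbot, le_bot_iff]
    -- transport `N` to a tfg closed normal subgroup of `G_F`
    let ι : E.arith ≃ₜ* absoluteGaloisGroup F := AbsTopI.isoArith e
    let N' : Subgroup (absoluteGaloisGroup F) := N.map ι.toMulEquiv.toMonoidHom
    have hN' : N'.Normal := Subgroup.Normal.map hN _ ι.surjective
    have hN'c : IsClosed (N' : Set (absoluteGaloisGroup F)) := by
      have : (N' : Set (absoluteGaloisGroup F)) = ι.toHomeomorph '' (N : Set E.arith) := by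
        ext y; simp [N']
      rw [this]
      exact (ι.toHomeomorph.isClosed_image).mpr hNc
    have htfg' : IsTopologicallyFinitelyGenerated N' := by
      have e' : N ≃ₜ* N' :=
        { (ι.toMulEquiv.subgroupMap N) with
          continuous_toFun := by
            refine Continuous.subtype_mk ?_ _
            exact ι.continuous.comp continuous_subtype_val
          continuous_invFun := by
            refine Continuous.subtype_mk ?_ _
            exact ι.symm.continuous.comp continuous_subtype_val }
      exact htfg.of_continuousMulEquiv e'
    have hN'bot : N' = ⊥ := galoisNF_tfgNormalSubgroup_trivial_holds F N' hN' hN'c htfg'.exists_finset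
    rw [eq_bot_iff]
    intro x hx
    have : ι x ∈ N' := ⟨x, hx, rfl⟩
    rw [hN'bot, Subgroup.mem_bot] at this
    rw [Subgroup.mem_bot]
    exact ι.injective (by rw [this, map_one])

/-! ### `k_NF` with the genuine action, the genuine `V⊚`, through the admissibility isomorphism -/

/-- The comparison homomorphism `Π_E → G_F`: the admissibility isomorphism when `E` is admissible (a CHOICE of one),
the trivial homomorphism otherwise. [cite: MochizukiAbsTopIII2015, Def 5.1 (ii) p.114] -/
def shadowHom (E : FundamentalExtension.{0}) : E.arith →ₜ* absoluteGaloisGroup F :=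
  if h : IsAdmissible F E then
    { toMonoidHom := (AbsTopI.isoArith (Classical.choice h)).toMulEquiv.toMonoidHom
      continuous_toFun := (AbsTopI.isoArith (Classical.choice h)).continuous }
  else 1

/-- `k_NF(Π_E) := F̄` with `Π_E` acting through `shadowHom` by the genuine Galois action.
[cite: MochizukiAbsTopIII2015, Def 5.1 (ii) p.114] -/
@[reducible] def shadowAction (E : FundamentalExtension.{0}) : MulSemiringAction E.arith (AlgebraicClosure F) :=
  MulSemiringAction.compHom (AlgebraicClosure F) (shadowHom F E).toMonoidHom

/-- `V⊚(Π_E)`: the GENUINE valuation pro-set `V⊚(F̄/F)` with `Π_E` acting through `shadowHom`.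
[cite: MochizukiAbsTopIII2015, Def 5.1 (ii) p.114] -/
def shadowProVal (E : FundamentalExtension.{0}) : GaloisProSet E.arith :=
  (NumberField.valuationProSet F).comap (shadowHom F E)

/-- At an admissible `E`, the decomposition group of a nonarchimedean local element is the preimage under the admissibility
isomorphism of Mathlib's decomposition subgroup of the valuation ring. [cite: MochizukiAbsTopIII2015, Def 5.1 (iii) p.115] -/
theorem decomp_shadowProVal_inr_inl (E : FundamentalExtension.{0}) (A : NumberFieldValuationProSet.NonArch F) :
    (shadowProVal F E).decomp (Sum.inr (Sum.inl A)) =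
      ((A.1.decompositionSubgroup F).comap (absoluteGaloisGroup.toAlgEquiv F).toMonoidHom).comap
        (shadowHom F E).toMonoidHom := by
  change ((NumberField.valuationProSet F).comap (shadowHom F E)).decomp _ = _
  rw [GaloisProSet.decomp_comap, NumberFieldValuationProSet.decomp_inr_inl]

/-! ### The archimedean stub data -/

/-- `X(Π_E, v)` at the shadow: the STUB Aut-holomorphic orbispace = a point, `A_X := ℂ`, `π₁^∧ := Δ_E` itself (NO geometry;
the tree's `AutHolOrbispace` carries no axioms). [cite: MochizukiAbsTopIII2015, Def 5.1 (ii) p.114] -/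
def shadowArchSpace (E : FundamentalExtension.{0}) (_v : (shadowProVal F E).arc) : AutHolOrbispace.{0} where
  carrier := PUnit
  fieldA := ℂ
  pi1Hat := E.geomGrp

/-- `δ_{ell,v}` at the shadow: the identity `Δ_E ≅ π₁^∧ (:= Δ_E)`. [cite: MochizukiAbsTopIII2015, Def 5.1 (ii) p.114] -/
def shadowDelta (E : FundamentalExtension.{0}) (v : (shadowProVal F E).arc) :
    E.geom ≃ₜ* (shadowArchSpace F E v).pi1Hat :=
  ContinuousMulEquiv.refl _

/-- The infinite place of `F̄` underlying an archimedean local element. [cite: MochizukiAbsTopIII2015, Def 5.1 (i) p.113] -/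
def arcPlace (E : FundamentalExtension.{0}) (v : (shadowProVal F E).arc) : InfinitePlace (AlgebraicClosure F) :=
  Classical.choose v.2

/-- `arcPlace` recovers `v`. [cite: MochizukiAbsTopIII2015, Def 5.1 (i) p.113] -/
theorem inr_inr_arcPlace (E : FundamentalExtension.{0}) (v : (shadowProVal F E).arc) :
    (Sum.inr (Sum.inr (arcPlace F E v)) : NumberFieldValuationProSet.Carrier F) = v.1 :=
  Classical.choose_spec v.2

/-- `κ_{ell,v} : k_NF(Π_E) = F̄ ↪ A_X = ℂ` at the shadow: the GENUINE complex embedding of the infinite place under `v`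
(Mathlib `InfinitePlace.embedding`; print's `κ` is "the natural inclusion" determined by the Aut-holomorphic structure, invisible
to the stub). [cite: MochizukiAbsTopIII2015, Def 5.1 (ii) p.114] -/
def shadowKappa (E : FundamentalExtension.{0}) (v : (shadowProVal F E).arc) :
    AlgebraicClosure F →+* (shadowArchSpace F E v).fieldA :=
  (arcPlace F E v).embedding

/-- The embedding `κ_{ell,v}` induces the place under `v`. [cite: MochizukiAbsTopIII2015, Def 5.1 (ii) p.114] -/
theorem mk_shadowKappa (E : FundamentalExtension.{0}) (v : (shadowProVal F E).arc) :
    InfinitePlace.mk (shadowKappa F E v) = arcPlace F E v :=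
  InfinitePlace.mk_embedding _

end NumberFieldShadow

end Literature.AnabelianGeometry.AbsoluteAnabelian

end
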